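import Summits.QuantumFields.YangMills.Theorems.PoincareLipschitzFlatOrganLetters
import Summits.QuantumFields.YangMills.Theorems.PoincareLipschitzFlatOrganBelowThreshold
import Summits.QuantumFields.YangMills.Theorems.PoincareLipschitzFlatOrganOfFlatCapped
import Summits.QuantumFields.YangMills.Theorems.PoincareLipschitzImproveCoreOfFlat
import HarnessLib

/-!
# The K2 organ is the flat halving on the compact band of levels `[Λ⋆, 21]` (LEAD RULING g9-11 (c))

Width seat ym-ust-19936-w3 g14 on `stmt-QuantumFields-19936` (`HistoryTailL`), helper file (no claim on the crux or a registered
stub; `--supports stmt-QuantumFields-19936 --as helper`; definition-free).  YM₃ on the torus is rung R3 of the ladder, NOT the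
Clay problem.

The K2 organ of record is the FROZEN flat text `hImproveCoreFlat` v1 (bac8eda3 = ✓K-5 `hImproveCore_of_flat`'s hypothesis `hF`):
flat `δ(ρ+1)`-almost-minimising unit lattice maps `ℤ³ → S³ ⊂ ℝ⁴` with `E(Q_R(z)) ≤ Λ₀R` have `E(Q_{2r}(z)) ≤ ε₁r` at one comparable
scale, for ALL `Λ₀, ε₁ > 0`.  Three kernel facts cut it down to a compact band of normalised energies:
* BELOW THRESHOLD (LEAD ✓K-6 `halving_below_threshold`): there is `Λ⋆ > 0` such that the HALVING instance `(Λ, Λ)` holds at every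
  level `0 < Λ ≤ Λ⋆` (★w5's log-free one step);
* ITERATION (§1, the band form of ★w7 g13's ✓`flat_of_halving`): the halving instances at the levels `Λ ≤ Λ₁` give the organ AT the
  level `Λ₁` (`hImproveCoreFlat∣_{Λ₀ := Λ₁}`), by `⌈log₂(8Λ₁∕ε₁)⌉` halvings and the trivial corner;
* ABOVE (★★★ ✓`hImproveCoreFlat_of_flatCapped`, the flat log-cutoff STABILITY CAP of Schoen–Uhlenbeck type on `ℤ³`):
  `hImproveCoreFlat∣_{Λ₀ := 21} ⟹ hImproveCoreFlat` v1 verbatim.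
Hence (§2) ★★★`hImproveCoreFlat_of_halving_band`: the organ follows from the halving instance on the band `Λ ∈ [Λ⋆, 21]` ALONE — one
parameter-free lattice `ε`-regularity statement at moderate normalised energy (the content of Schoen–Uhlenbeck 1982∕84 + Luckhaus 1988
on `ℤ³`, NOT in print for lattice maps; NOT proved here).  §3 records the twisted corollary through ✓K-5.

References: R. Schoen, K. Uhlenbeck, J. Differential Geom. 17 (1982) 307–335, §2 (energy improvement by iteration); R. Schoen,
K. Uhlenbeck, Invent. Math. 78 (1984) 89–100, §2 (stability ⟹ energy cap); the lattice statements are this cell's (folklore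
bookkeeping over the cited schemes).
-/

open scoped BigOperators InnerProductSpace
open Finset

noncomputable section

namespace Summit.QuantumFields.YangMills.Theorems.PoincareLipschitzFlatOrganOfBandHalving

open Literature.MathematicalPhysics.QuantumFieldTheory.Balaban1983to89
open B4Eq19LatticeOperators (Zd box unitVec)
open Summit.QuantumFields.YangMills.Theorems.PoincareLipschitzFlatOrganLetters (flat_compose flat_trivial_of_le)
open Summit.QuantumFields.YangMills.Theorems.PoincareLipschitzFlatOrganBelowThreshold (halving_below_threshold)
open Summit.QuantumFields.YangMills.Theorems.PoincareLipschitzFlatOrganOfFlatCapped (hImproveCoreFlat_of_flatCapped)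
open Summit.QuantumFields.YangMills.Theorems.PoincareLipschitzImproveCoreOfFlat (hImproveCore_of_flat)

/-! ## §1 The band form of the halving iteration -/

/-- Iteration engine (band form of ✓`flat_of_halving_aux`, w7 g13's induction verbatim): from the halving instance at every level `Λ ≤ Λ₁`
and the trivial corner, the organ's conclusion at `(Λ₀, ε₁)` for every `0 < Λ₀ ≤ min(Λ₁, 2ⁿ·ε₁∕8)`. [folklore] [cite: SchoenUhlenbeck1982, §2] -/
theorem flatAt_of_halving_le_aux {Λ₁ : ℝ}
    (H : ∀ Λ : ℝ, 0 < Λ → Λ ≤ Λ₁ →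
      ∃ (δ C₀ R₀ : ℝ), 0 < δ ∧ 1 ≤ C₀ ∧ 1 ≤ R₀ ∧
      ∀ (u : Zd 3 → EuclideanSpace ℝ (Fin 4)) (z : Zd 3) (R : ℤ),
        R₀ ≤ R →
        (∀ y, ‖u y‖ = 1) →
        (∀ (z' : Zd 3) (ρ : ℤ), 0 ≤ ρ → box z' (ρ + 1) ⊆ box z R →
          ∀ v : Zd 3 → EuclideanSpace ℝ (Fin 4), (∀ y, y ∉ box z' ρ → v y = u y) → (∀ y ∈ box z' ρ, ‖v y‖ = 1) →
            ∑ y ∈ box z' (ρ + 1), ∑ μ : Fin 3, ‖u (y + unitVec μ) - u y‖ ^ 2 ≤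
              (∑ y ∈ box z' (ρ + 1), ∑ μ : Fin 3, ‖v (y + unitVec μ) - v y‖ ^ 2) + δ * ((ρ : ℝ) + 1)) →
        (∑ y ∈ box z R, ∑ μ : Fin 3, ‖u (y + unitVec μ) - u y‖ ^ 2 ≤ Λ * R) →
        ∃ r : ℤ, 1 ≤ r ∧ (R : ℝ) ≤ C₀ * r ∧ 4 * r ≤ R ∧
          ∑ y ∈ box z (2 * r), ∑ μ : Fin 3, ‖u (y + unitVec μ) - u y‖ ^ 2 ≤ Λ * r)
    (ε₁ : ℝ) (n : ℕ) :
    ∀ Λ₀ : ℝ, 0 < Λ₀ → Λ₀ ≤ Λ₁ → Λ₀ ≤ 2 ^ n * (ε₁ / 8) →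
    ∃ (δ C₀ R₀ : ℝ), 0 < δ ∧ 1 ≤ C₀ ∧ 1 ≤ R₀ ∧
      ∀ (u : Zd 3 → EuclideanSpace ℝ (Fin 4)) (z : Zd 3) (R : ℤ),
        R₀ ≤ R →
        (∀ y, ‖u y‖ = 1) →
        (∀ (z' : Zd 3) (ρ : ℤ), 0 ≤ ρ → box z' (ρ + 1) ⊆ box z R →
          ∀ v : Zd 3 → EuclideanSpace ℝ (Fin 4), (∀ y, y ∉ box z' ρ → v y = u y) → (∀ y ∈ box z' ρ, ‖v y‖ = 1) →
            ∑ y ∈ box z' (ρ + 1), ∑ μ : Fin 3, ‖u (y + unitVec μ) - u y‖ ^ 2 ≤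
              (∑ y ∈ box z' (ρ + 1), ∑ μ : Fin 3, ‖v (y + unitVec μ) - v y‖ ^ 2) + δ * ((ρ : ℝ) + 1)) →
        (∑ y ∈ box z R, ∑ μ : Fin 3, ‖u (y + unitVec μ) - u y‖ ^ 2 ≤ Λ₀ * R) →
        ∃ r : ℤ, 1 ≤ r ∧ (R : ℝ) ≤ C₀ * r ∧ 4 * r ≤ R ∧
          ∑ y ∈ box z (2 * r), ∑ μ : Fin 3, ‖u (y + unitVec μ) - u y‖ ^ 2 ≤ ε₁ * r := by
  induction n with
  | zero =>
    intro Λ₀ hΛ₀ _ hle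
    exact flat_trivial_of_le Λ₀ ε₁ hΛ₀ (by rw [pow_zero, one_mul] at hle; linarith)
  | succ n ih =>
    intro Λ₀ hΛ₀ hΛ₀₁ hle
    have hhalf : Λ₀ / 2 ≤ 2 ^ n * (ε₁ / 8) := by rw [pow_succ] at hle; linarith
    have h₂ := ih (Λ₀ / 2) (by positivity) (by linarith) hhalf
    exact flat_compose (H Λ₀ hΛ₀ hΛ₀₁) h₂

/-- ★★ **THE BAND FORM OF THE HALVING NORMAL FORM**: the halving instance at every level `0 < Λ ≤ Λ₁` gives the flat organ AT THE LEVEL `Λ₁`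
(`hImproveCoreFlat` v1 with `∀Λ₀` deleted and `Λ₀ * R ↦ Λ₁ * R`) — `⌈log₂(8Λ₁∕ε₁)⌉` halvings, each at a level `≤ Λ₁`. [folklore] [cite: SchoenUhlenbeck1982, §2] -/
theorem flatAt_of_halving_le {Λ₁ : ℝ} (hΛ₁ : 0 < Λ₁)
    (H : ∀ Λ : ℝ, 0 < Λ → Λ ≤ Λ₁ →
      ∃ (δ C₀ R₀ : ℝ), 0 < δ ∧ 1 ≤ C₀ ∧ 1 ≤ R₀ ∧
      ∀ (u : Zd 3 → EuclideanSpace ℝ (Fin 4)) (z : Zd 3) (R : ℤ),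
        R₀ ≤ R →
        (∀ y, ‖u y‖ = 1) →
        (∀ (z' : Zd 3) (ρ : ℤ), 0 ≤ ρ → box z' (ρ + 1) ⊆ box z R →
          ∀ v : Zd 3 → EuclideanSpace ℝ (Fin 4), (∀ y, y ∉ box z' ρ → v y = u y) → (∀ y ∈ box z' ρ, ‖v y‖ = 1) →
            ∑ y ∈ box z' (ρ + 1), ∑ μ : Fin 3, ‖u (y + unitVec μ) - u y‖ ^ 2 ≤
              (∑ y ∈ box z' (ρ + 1), ∑ μ : Fin 3, ‖v (y + unitVec μ) - v y‖ ^ 2) + δ * ((ρ : ℝ) + 1)) →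
        (∑ y ∈ box z R, ∑ μ : Fin 3, ‖u (y + unitVec μ) - u y‖ ^ 2 ≤ Λ * R) →
        ∃ r : ℤ, 1 ≤ r ∧ (R : ℝ) ≤ C₀ * r ∧ 4 * r ≤ R ∧
          ∑ y ∈ box z (2 * r), ∑ μ : Fin 3, ‖u (y + unitVec μ) - u y‖ ^ 2 ≤ Λ * r) :
    ∀ (ε₁ : ℝ), 0 < ε₁ →
    ∃ (δ C₀ R₀ : ℝ), 0 < δ ∧ 1 ≤ C₀ ∧ 1 ≤ R₀ ∧
      ∀ (u : Zd 3 → EuclideanSpace ℝ (Fin 4)) (z : Zd 3) (R : ℤ),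
        R₀ ≤ R →
        (∀ y, ‖u y‖ = 1) →
        (∀ (z' : Zd 3) (ρ : ℤ), 0 ≤ ρ → box z' (ρ + 1) ⊆ box z R →
          ∀ v : Zd 3 → EuclideanSpace ℝ (Fin 4), (∀ y, y ∉ box z' ρ → v y = u y) → (∀ y ∈ box z' ρ, ‖v y‖ = 1) →
            ∑ y ∈ box z' (ρ + 1), ∑ μ : Fin 3, ‖u (y + unitVec μ) - u y‖ ^ 2 ≤
              (∑ y ∈ box z' (ρ + 1), ∑ μ : Fin 3, ‖v (y + unitVec μ) - v y‖ ^ 2) + δ * ((ρ : ℝ) + 1)) →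
        (∑ y ∈ box z R, ∑ μ : Fin 3, ‖u (y + unitVec μ) - u y‖ ^ 2 ≤ Λ₁ * R) →
        ∃ r : ℤ, 1 ≤ r ∧ (R : ℝ) ≤ C₀ * r ∧ 4 * r ≤ R ∧
          ∑ y ∈ box z (2 * r), ∑ μ : Fin 3, ‖u (y + unitVec μ) - u y‖ ^ 2 ≤ ε₁ * r := by
  intro ε₁ hε₁
  obtain ⟨n, hn⟩ := pow_unbounded_of_one_lt (8 * Λ₁ / ε₁) (by norm_num : (1 : ℝ) < 2)
  have hle : Λ₁ ≤ 2 ^ n * (ε₁ / 8) := by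
    have h1 : 8 * Λ₁ / ε₁ * ε₁ = 8 * Λ₁ := by field_simp
    have h2 : 8 * Λ₁ ≤ 2 ^ n * ε₁ := by
      rw [← h1]; exact le_of_lt (by nlinarith [mul_lt_mul_of_pos_right hn hε₁])
    linarith
  exact flatAt_of_halving_le_aux H ε₁ n Λ₁ hΛ₁ le_rfl hle

/-! ## §2 ★★★ The K2 organ is the flat halving on the band `[Λ⋆, 21]` -/

/-- ★★★ **THE K2 ORGAN OF RECORD ⟸ FLAT HALVING ON A COMPACT BAND OF LEVELS** (LEAD RULING g9-11 (c)).  There is `Λ⋆ > 0` (LEAD's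
K-6 threshold) such that: if for every level `Λ ∈ [Λ⋆, 21]` flat `δ(ρ+1)`-almost-minimising unit `ℝ⁴`-valued lattice maps on `ℤ³`
with `E(Q_R(z)) ≤ ΛR`, `R ≥ R₀(Λ)`, have `E(Q_{2r}(z)) ≤ Λr` at ONE scale `r ∈ [R∕C₀(Λ), R∕4]` (the halving instance `(Λ, Λ)` of the organ,
★w7 g13's binder VERBATIM), then the FROZEN organ `hImproveCoreFlat` v1 (bac8eda3) holds VERBATIM — below `Λ⋆` by
✓`halving_below_threshold`, on `(0, 21]` by cases, `⟨Flat∣₂₁⟩` by §1, the organ by ★★★✓`hImproveCoreFlat_of_flatCapped` (the flat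
log-cutoff stability cap).  With the display of record ✓`historyTailL_of_hImproveCoreFlat`:
`HistoryTailL ⟸ {K1-exp, ⟨halving on [Λ⋆, 21]⟩, MeanDeviationL}`. [cite: SchoenUhlenbeck1982, §2; SchoenUhlenbeck1984, §2] -/
theorem hImproveCoreFlat_of_halving_band : ∃ Λs : ℝ, 0 < Λs ∧
    ((∀ Λ : ℝ, Λs ≤ Λ → Λ ≤ 21 →
      ∃ (δ C₀ R₀ : ℝ), 0 < δ ∧ 1 ≤ C₀ ∧ 1 ≤ R₀ ∧
      ∀ (u : Zd 3 → EuclideanSpace ℝ (Fin 4)) (z : Zd 3) (R : ℤ),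
        R₀ ≤ R →
        (∀ y, ‖u y‖ = 1) →
        (∀ (z' : Zd 3) (ρ : ℤ), 0 ≤ ρ → box z' (ρ + 1) ⊆ box z R →
          ∀ v : Zd 3 → EuclideanSpace ℝ (Fin 4), (∀ y, y ∉ box z' ρ → v y = u y) → (∀ y ∈ box z' ρ, ‖v y‖ = 1) →
            ∑ y ∈ box z' (ρ + 1), ∑ μ : Fin 3, ‖u (y + unitVec μ) - u y‖ ^ 2 ≤
              (∑ y ∈ box z' (ρ + 1), ∑ μ : Fin 3, ‖v (y + unitVec μ) - v y‖ ^ 2) + δ * ((ρ : ℝ) + 1)) →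
        (∑ y ∈ box z R, ∑ μ : Fin 3, ‖u (y + unitVec μ) - u y‖ ^ 2 ≤ Λ * R) →
        ∃ r : ℤ, 1 ≤ r ∧ (R : ℝ) ≤ C₀ * r ∧ 4 * r ≤ R ∧
          ∑ y ∈ box z (2 * r), ∑ μ : Fin 3, ‖u (y + unitVec μ) - u y‖ ^ 2 ≤ Λ * r) →
    ∀ (Λ₀ ε₁ : ℝ), 0 < Λ₀ → 0 < ε₁ →
      ∃ (δ C₀ R₀ : ℝ), 0 < δ ∧ 1 ≤ C₀ ∧ 1 ≤ R₀ ∧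
      ∀ (u : Zd 3 → EuclideanSpace ℝ (Fin 4)) (z : Zd 3) (R : ℤ),
      R₀ ≤ R →
      (∀ y, ‖u y‖ = 1) →
      (∀ (z' : Zd 3) (ρ : ℤ), 0 ≤ ρ → box z' (ρ + 1) ⊆ box z R →
      ∀ v : Zd 3 → EuclideanSpace ℝ (Fin 4), (∀ y, y ∉ box z' ρ → v y = u y) → (∀ y ∈ box z' ρ, ‖v y‖ = 1) →
      ∑ y ∈ box z' (ρ + 1), ∑ μ : Fin 3, ‖u (y + unitVec μ) - u y‖ ^ 2 ≤
      (∑ y ∈ box z' (ρ + 1), ∑ μ : Fin 3, ‖v (y + unitVec μ) - v y‖ ^ 2) + δ * ((ρ : ℝ) + 1)) →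
      (∑ y ∈ box z R, ∑ μ : Fin 3, ‖u (y + unitVec μ) - u y‖ ^ 2 ≤ Λ₀ * R) →
      ∃ r : ℤ, 1 ≤ r ∧ (R : ℝ) ≤ C₀ * r ∧ 4 * r ≤ R ∧
      ∑ y ∈ box z (2 * r), ∑ μ : Fin 3, ‖u (y + unitVec μ) - u y‖ ^ 2 ≤ ε₁ * r) := by
  obtain ⟨Λs, hΛs, hsmall⟩ := halving_below_threshold
  refine ⟨Λs, hΛs, fun hband => ?_⟩
  have hall : ∀ Λ : ℝ, 0 < Λ → Λ ≤ 21 →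
      ∃ (δ C₀ R₀ : ℝ), 0 < δ ∧ 1 ≤ C₀ ∧ 1 ≤ R₀ ∧
      ∀ (u : Zd 3 → EuclideanSpace ℝ (Fin 4)) (z : Zd 3) (R : ℤ),
        R₀ ≤ R →
        (∀ y, ‖u y‖ = 1) →
        (∀ (z' : Zd 3) (ρ : ℤ), 0 ≤ ρ → box z' (ρ + 1) ⊆ box z R →
          ∀ v : Zd 3 → EuclideanSpace ℝ (Fin 4), (∀ y, y ∉ box z' ρ → v y = u y) → (∀ y ∈ box z' ρ, ‖v y‖ = 1) →
            ∑ y ∈ box z' (ρ + 1), ∑ μ : Fin 3, ‖u (y + unitVec μ) - u y‖ ^ 2 ≤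
              (∑ y ∈ box z' (ρ + 1), ∑ μ : Fin 3, ‖v (y + unitVec μ) - v y‖ ^ 2) + δ * ((ρ : ℝ) + 1)) →
        (∑ y ∈ box z R, ∑ μ : Fin 3, ‖u (y + unitVec μ) - u y‖ ^ 2 ≤ Λ * R) →
        ∃ r : ℤ, 1 ≤ r ∧ (R : ℝ) ≤ C₀ * r ∧ 4 * r ≤ R ∧
          ∑ y ∈ box z (2 * r), ∑ μ : Fin 3, ‖u (y + unitVec μ) - u y‖ ^ 2 ≤ Λ * r := by
    intro Λ hΛ hΛ21
    by_cases h : Λ ≤ Λs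
    · exact hsmall Λ hΛ h
    · exact hband Λ (le_of_lt (not_le.mp h)) hΛ21
  exact hImproveCoreFlat_of_flatCapped (flatAt_of_halving_le (by norm_num) hall)

/-! ## §3 The twisted corollary -/

/-- ★★ COROLLARY (∘ LEAD ✓K-5 `hImproveCore_of_flat`): the same band hypothesis gives the FROZEN twisted organ `hImproveCore` v1
(7446c95a, ✓K-4b's `hCore`) VERBATIM — the door for consumers wired to the twisted letter. [cite: SchoenUhlenbeck1982, §2] -/
theorem hImproveCore_of_halving_band : ∃ Λs : ℝ, 0 < Λs ∧
    ((∀ Λ : ℝ, Λs ≤ Λ → Λ ≤ 21 →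
      ∃ (δ C₀ R₀ : ℝ), 0 < δ ∧ 1 ≤ C₀ ∧ 1 ≤ R₀ ∧
      ∀ (u : Zd 3 → EuclideanSpace ℝ (Fin 4)) (z : Zd 3) (R : ℤ),
        R₀ ≤ R →
        (∀ y, ‖u y‖ = 1) →
        (∀ (z' : Zd 3) (ρ : ℤ), 0 ≤ ρ → box z' (ρ + 1) ⊆ box z R →
          ∀ v : Zd 3 → EuclideanSpace ℝ (Fin 4), (∀ y, y ∉ box z' ρ → v y = u y) → (∀ y ∈ box z' ρ, ‖v y‖ = 1) →
            ∑ y ∈ box z' (ρ + 1), ∑ μ : Fin 3, ‖u (y + unitVec μ) - u y‖ ^ 2 ≤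
              (∑ y ∈ box z' (ρ + 1), ∑ μ : Fin 3, ‖v (y + unitVec μ) - v y‖ ^ 2) + δ * ((ρ : ℝ) + 1)) →
        (∑ y ∈ box z R, ∑ μ : Fin 3, ‖u (y + unitVec μ) - u y‖ ^ 2 ≤ Λ * R) →
        ∃ r : ℤ, 1 ≤ r ∧ (R : ℝ) ≤ C₀ * r ∧ 4 * r ≤ R ∧
          ∑ y ∈ box z (2 * r), ∑ μ : Fin 3, ‖u (y + unitVec μ) - u y‖ ^ 2 ≤ Λ * r) →
    ∀ (Λ₀ ε₁ : ℝ), 0 < Λ₀ → 0 < ε₁ →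
    ∃ (C₀ R₀ : ℝ), 1 ≤ C₀ ∧ 1 ≤ R₀ ∧
    ∀ (u : Zd 3 → EuclideanSpace ℝ (Fin 4)) (τ : Fin 3 → Zd 3 → (EuclideanSpace ℝ (Fin 4) ≃ₗᵢ[ℝ] EuclideanSpace ℝ (Fin 4)))
    (z : Zd 3) (R : ℤ) (τ₀ : ℝ),
    R₀ ≤ R →
    (∀ y, ‖u y‖ = 1) →
    (∀ y ∈ box z (R + 1), ∀ (μ : Fin 3) (w : EuclideanSpace ℝ (Fin 4)), ‖τ μ y w - w‖ ≤ τ₀ * ‖w‖) →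
    τ₀ * (R : ℝ) ≤ C₀⁻¹ →
    (∀ y ∈ box z R,
    ‖∑ μ : Fin 3, (τ μ y (u (y + unitVec μ)) + (τ μ (y - unitVec μ)).symm (u (y - unitVec μ)))‖ • u y =
    ∑ μ : Fin 3, (τ μ y (u (y + unitVec μ)) + (τ μ (y - unitVec μ)).symm (u (y - unitVec μ)))) →
    (∀ (z' : Zd 3) (R' : ℤ), 0 ≤ R' → box z' (R' + 1) ⊆ box z R →
    ∀ v : Zd 3 → EuclideanSpace ℝ (Fin 4), (∀ y, y ∉ box z' R' → v y = u y) → (∀ y ∈ box z' R', ‖v y‖ = 1) →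
    ∑ y ∈ box z' (R' + 1), ∑ μ : Fin 3, ‖τ μ y (u (y + unitVec μ)) - u y‖ ^ 2 ≤
    ∑ y ∈ box z' (R' + 1), ∑ μ : Fin 3, ‖τ μ y (v (y + unitVec μ)) - v y‖ ^ 2) →
    (∑ y ∈ box z R, ∑ μ : Fin 3, ‖τ μ y (u (y + unitVec μ)) - u y‖ ^ 2 ≤ Λ₀ * R) →
    ∃ r : ℤ, 1 ≤ r ∧ (R : ℝ) ≤ C₀ * r ∧ 4 * r ≤ R ∧
    ∑ y ∈ box z (2 * r), ∑ μ : Fin 3, ‖τ μ y (u (y + unitVec μ)) - u y‖ ^ 2 ≤ ε₁ * r) := by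
  obtain ⟨Λs, hΛs, h⟩ := hImproveCoreFlat_of_halving_band
  exact ⟨Λs, hΛs, fun hband => hImproveCore_of_flat (h hband)⟩

end Summit.QuantumFields.YangMills.Theorems.PoincareLipschitzFlatOrganOfBandHalving

end
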